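import Summits.SmoothPoincare4.SmoothPoincare4.Theorems.SymplecticOrigamiGromovRecognitionRelEndStubTameJAux3
import Literature.Geometry.Symplectic.GromovR4RelEndProofs
import Mathlib
import HarnessLib

/-!
# The pointwise tame complex structure `F(A, τ, p)` of a `σ`-symmetric positive endomorphism
(helper file 4 for stub `stub_tameJ` of line `cross-cap-laurent`, crux `GromovRecognitionRelEnd`,
item stmt-SmoothPoincare4-11009)

Pointwise content of McDuff–Salamon (2017), Prop. 2.5.6 / §4.1 (4.1.3) in dimension four, in
closed form. Let `σ` be a `2`-form on `ℝ⁴` and `A ∈ End(ℝ⁴)` with `g(v, w) := σ(v, A w)` symmetric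
and positive definite (so `σ` is nondegenerate, `A` is `g`-skew, and `A = g⁻¹σ` up to sign). With
the trace invariants `τ = -tr(A²)/2`, `p = τ²/2 - tr(A⁴)/4` and the formula
`F = (√p √(τ + 2√p))⁻¹ A (A² + (τ + √p))` of the helper files 2–3:

* `polar_spec_std` (`σ = ω₀`) and `polar_spec` (any `σ`, through a linear symplectic frame
  `Ψ*σ = ω₀`, `exists_continuousLinearEquiv_twoForm_eq_stdSymplecticForm`): `p > 0`,
  `τ + 2√p > 0`, `F² = -1` and `σ(v, F v) > 0` for `v ≠ 0` — `F` is a `σ`-TAME complex structure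
  (indeed the `σ`-compatible polar part `A(-A²)^{-1/2}`);
* the two inequalities behind it, for `ω₀`: `τ σ(v, Av) ≥ σ(Av, A²v)`-type positivity
  (`tau_mul_sub_nonneg`, from Cayley–Hamilton: `w = (A² + τ)v` has `A² w = -p v`) and `τ > 0`
  (`tau_pos_of_stdSym`);
* registered helper sub-goal `helper_tamePolarExists`: the existence statement "a `σ`-symmetric
  positive `A` yields a `σ`-tame complex structure of `ℝ⁴`".

Everything is proved; no definition, no named fact.

References: D. McDuff, D. Salamon, *Introduction to Symplectic Topology*, 3rd ed. (2017),
Prop. 2.5.6, §4.1 (4.1.1)–(4.1.3) [McDuffSalamon2017].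
-/

noncomputable section

-- the registered namespace `Summit.SmoothPoincare4.SmoothPoincare4.Theorems…` repeats a component
set_option linter.dupNamespace false

open scoped Topology
open Literature.Geometry.Symplectic

namespace Summit.SmoothPoincare4.SmoothPoincare4.Theorems.GromovRecognitionRelEnd.CrossCapLaurent

/-! ### The standard case `σ = ω₀` -/

section Std

variable {A : EuclideanSpace ℝ (Fin 4) →L[ℝ] EuclideanSpace ℝ (Fin 4)}
  (hsym : ∀ a c : EuclideanSpace ℝ (Fin 4), stdSymplecticForm a (A c) = stdSymplecticForm c (A a))
include hsym

/-- `A` is skew for `g = ω₀(·, A ·)`: `ω₀(v, A(A(Av))) = -ω₀(Av, A(Av))`. [folklore] -/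
theorem std_apply_cube (v : EuclideanSpace ℝ (Fin 4)) :
    stdSymplecticForm v (A (A (A v))) = -stdSymplecticForm (A v) (A (A v)) := by
  rw [hsym v (A (A v)), stdSymplecticForm_swap]

omit hsym in
/-- `ω₀(v, A(Xv + c v)) = ω₀(v, A(Xv)) + c ω₀(v, Av)` (linearity in the second slot). [folklore] -/
theorem std_apply_add_smul (X : EuclideanSpace ℝ (Fin 4) →L[ℝ] EuclideanSpace ℝ (Fin 4)) (c : ℝ)
    (v : EuclideanSpace ℝ (Fin 4)) :
    stdSymplecticForm v (A ((X + c • (1 : EuclideanSpace ℝ (Fin 4) →L[ℝ] EuclideanSpace ℝ (Fin 4))) v)) =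
      stdSymplecticForm v (A (X v)) + c * stdSymplecticForm v (A v) := by
  show stdSymplecticForm v (A (X v + c • v)) = _
  rw [← stdSymplecticBilin_apply, ← stdSymplecticBilin_apply, ← stdSymplecticBilin_apply, map_add,
    map_smul, map_add, map_smul, smul_eq_mul]

variable {τ p : ℝ}
  (hCH : A * A * (A * A) + τ • (A * A) + p • (1 : EuclideanSpace ℝ (Fin 4) →L[ℝ] EuclideanSpace ℝ (Fin 4)) = 0)
  (hp : 0 < p)
include hCH hp

/-- **The key positivity** `τ ω₀(v, Av) - ω₀(Av, A(Av)) ≥ 0`: with `w = A²v + τ v` the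
Cayley–Hamilton relation gives `A² w = -p v`, and `g(v, w) = g(w, v) = p⁻¹ ω₀(Aw, A(Aw)) ≥ 0` when
`ω₀(u, Au) ≥ 0` for all `u`. [cite: McDuffSalamon2017, Prop. 2.5.6] -/
theorem tau_mul_sub_nonneg (hnn : ∀ u : EuclideanSpace ℝ (Fin 4), 0 ≤ stdSymplecticForm u (A u))
    (v : EuclideanSpace ℝ (Fin 4)) :
    0 ≤ τ * stdSymplecticForm v (A v) - stdSymplecticForm (A v) (A (A v)) := by
  set w : EuclideanSpace ℝ (Fin 4) := A (A v) + τ • v with hw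
  -- `A (A w) = -p • v`
  have hAAw : A (A w) = -p • v := by
    have h' : A (A (A (A v))) + τ • A (A v) + p • v = 0 :=
      congrArg (fun X : EuclideanSpace ℝ (Fin 4) →L[ℝ] EuclideanSpace ℝ (Fin 4) ↦ X v) hCH
    rw [hw, map_add, map_add, map_smul, map_smul, neg_smul, eq_neg_iff_add_eq_zero]
    exact h'
  -- `g(v, w) = τ n(v) - n(Av)`
  have h1 : stdSymplecticForm v (A w) = τ * stdSymplecticForm v (A v) - stdSymplecticForm (A v) (A (A v)) := by
    rw [hw, map_add, map_smul, ← stdSymplecticBilin_apply, map_add, map_smul, stdSymplecticBilin_apply,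
      stdSymplecticBilin_apply, std_apply_cube hsym, smul_eq_mul]
    ring
  -- `g(v, w) = g(w, v) = -p⁻¹ ω₀(w, A(A(Aw))) = p⁻¹ n(Aw)`
  have h2 : stdSymplecticForm v (A w) = p⁻¹ * stdSymplecticForm (A w) (A (A w)) := by
    have hv : v = (-p⁻¹) • A (A w) := by
      rw [hAAw, smul_smul]
      field_simp
      simp
    rw [hsym v w]
    conv_lhs => rw [hv, map_smul, ← stdSymplecticBilin_apply, map_smul, stdSymplecticBilin_apply,
      std_apply_cube hsym, smul_eq_mul]
    ring
  rw [← h1, h2]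
  exact mul_nonneg (inv_nonneg.2 hp.le) (hnn _)

variable (hpos : ∀ a : EuclideanSpace ℝ (Fin 4), a ≠ 0 → 0 < stdSymplecticForm a (A a))
include hpos

omit hCH hp hsym in
/-- `A` is injective when `ω₀(·, A ·)` is positive definite. [folklore] -/
theorem apply_ne_zero_of_stdPos {v : EuclideanSpace ℝ (Fin 4)} (hv : v ≠ 0) : A v ≠ 0 := by
  intro h
  have := hpos v hv
  rw [h] at this
  simp [stdSymplecticForm] at this

/-- **`τ > 0`**: `τ ω₀(v, Av) ≥ ω₀(Av, A(Av)) > 0` for any `v ≠ 0`. [folklore] -/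
theorem tau_pos_of_stdSym : 0 < τ := by
  set v : EuclideanSpace ℝ (Fin 4) := EuclideanSpace.single 0 1 with hv
  have hv0 : v ≠ 0 := by
    intro h
    have := congrArg (fun x : EuclideanSpace ℝ (Fin 4) ↦ x 0) h
    simp [hv] at this
  have h1 := tau_mul_sub_nonneg hsym hCH hp (fun u ↦ by
    by_cases hu : u = 0
    · subst hu; simp [stdSymplecticForm]
    · exact (hpos u hu).le) v
  have h2 := hpos v hv0
  have h3 := hpos (A v) (apply_ne_zero_of_stdPos hpos hv0)
  nlinarith

/-- **The standard case.** For `ω₀(·, A ·)` symmetric positive definite and `τ, p` the trace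
invariants of `A`: `p > 0`, `τ + 2√p > 0`, `F(A, τ, p)² = -1` and `ω₀(v, F v) > 0` for
`v ≠ 0` (`ω₀(v, F v) = c (d ω₀(v, Av) - ω₀(Av, A²v)) ≥ c √p ω₀(v, Av)`, `c > 0`).
McDuff–Salamon (2017), Prop. 2.5.6. [cite: McDuffSalamon2017, Prop. 2.5.6] -/
theorem polar_spec_std' :
    0 < τ + 2 * √p ∧
    ((√p * √(τ + 2 * √p))⁻¹ • (A * (A * A + (τ + √p) • 1))) *
        ((√p * √(τ + 2 * √p))⁻¹ • (A * (A * A + (τ + √p) • 1))) = -1 ∧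
    ∀ v : EuclideanSpace ℝ (Fin 4), v ≠ 0 →
      0 < stdSymplecticForm v
        (((√p * √(τ + 2 * √p))⁻¹ • (A * (A * A + (τ + √p) • 1))) v) := by
  have hτ : 0 < τ := tau_pos_of_stdSym hsym hCH hp hpos
  have hs : 0 < τ + 2 * √p := by positivity
  refine ⟨hs, polar_mul_self A hp hs hCH, fun v hv ↦ ?_⟩
  have hc : 0 < (√p * √(τ + 2 * √p))⁻¹ := by positivity
  show 0 < stdSymplecticForm v ((√p * √(τ + 2 * √p))⁻¹ • ((A * (A * A + (τ + √p) • 1)) v))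
  rw [← stdSymplecticBilin_apply, map_smul, stdSymplecticBilin_apply, smul_eq_mul]
  refine mul_pos hc ?_
  have e : stdSymplecticForm v ((A * (A * A + (τ + √p) • 1)) v) =
      (τ + √p) * stdSymplecticForm v (A v) - stdSymplecticForm (A v) (A (A v)) := by
    rw [show (A * (A * A + (τ + √p) • 1)) v = A ((A * A + (τ + √p) • 1) v) from rfl,
      std_apply_add_smul, show (A * A) v = A (A v) from rfl, std_apply_cube hsym]
    ring
  rw [e]
  have h1 := tau_mul_sub_nonneg hsym hCH hp (fun u ↦ by
    by_cases hu : u = 0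
    · subst hu; simp [stdSymplecticForm]
    · exact (hpos u hu).le) v
  have h2 := hpos v hv
  have h3 : 0 < √p := Real.sqrt_pos.2 hp
  nlinarith

end Std

/-- **The standard case with the trace invariants.** For `ω₀(·, A ·)` symmetric positive definite,
`τ = -tr(A²)/2` and `p = τ²/2 - tr(A⁴)/4`: `p > 0`, `τ + 2√p > 0`, `F² = -1`, and `F` is
`ω₀`-tame. [cite: McDuffSalamon2017, Prop. 2.5.6] -/
theorem polar_spec_std {A : EuclideanSpace ℝ (Fin 4) →L[ℝ] EuclideanSpace ℝ (Fin 4)}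
    (hsym : ∀ a c : EuclideanSpace ℝ (Fin 4), stdSymplecticForm a (A c) = stdSymplecticForm c (A a))
    (hpos : ∀ a : EuclideanSpace ℝ (Fin 4), a ≠ 0 → 0 < stdSymplecticForm a (A a)) {τ p : ℝ}
    (hτ : τ = -(LinearMap.trace ℝ (EuclideanSpace ℝ (Fin 4))
      ((A * A : EuclideanSpace ℝ (Fin 4) →L[ℝ] EuclideanSpace ℝ (Fin 4)) :
        EuclideanSpace ℝ (Fin 4) →ₗ[ℝ] EuclideanSpace ℝ (Fin 4))) / 2)
    (hp : p = τ ^ 2 / 2 - LinearMap.trace ℝ (EuclideanSpace ℝ (Fin 4))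
      ((A * A * (A * A) : EuclideanSpace ℝ (Fin 4) →L[ℝ] EuclideanSpace ℝ (Fin 4)) :
        EuclideanSpace ℝ (Fin 4) →ₗ[ℝ] EuclideanSpace ℝ (Fin 4)) / 4) :
    0 < p ∧ 0 < τ + 2 * √p ∧
    ((√p * √(τ + 2 * √p))⁻¹ • (A * (A * A + (τ + √p) • 1))) *
        ((√p * √(τ + 2 * √p))⁻¹ • (A * (A * A + (τ + √p) • 1))) = -1 ∧
    ∀ v : EuclideanSpace ℝ (Fin 4), v ≠ 0 →
      0 < stdSymplecticForm v
        (((√p * √(τ + 2 * √p))⁻¹ • (A * (A * A + (τ + √p) • 1))) v) := by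
  have hCH := ch_of_stdSym hsym
  have hp0 := pTrace_pos_of_stdSym hsym hpos
  rw [← hτ] at hCH hp0
  rw [← hp] at hCH hp0
  exact ⟨hp0, polar_spec_std' hsym hCH hp0 hpos⟩

/-! ### The general case, through a linear symplectic frame -/

/-- **Pointwise tame complex structure from a `σ`-symmetric positive endomorphism**
(McDuff–Salamon (2017), Prop. 2.5.6 / (4.1.3), dimension four, closed form). Let `σ` be a
`2`-form on `ℝ⁴` and `A ∈ End(ℝ⁴)` with `σ(v, Aw)` symmetric and positive definite, and let
`τ = -tr(A²)/2`, `p = τ²/2 - tr(A⁴)/4`. Then `p > 0`, `τ + 2√p > 0`,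
`F = (√p √(τ + 2√p))⁻¹ A (A² + (τ + √p))` satisfies `F² = -1`, and `σ(v, F v) > 0` for `v ≠ 0`.
Proof: a frame `Ψ` with `Ψ*σ = ω₀` (`exists_continuousLinearEquiv_twoForm_eq_stdSymplecticForm`)
conjugates `A` to an `ω₀`-symmetric positive `A' = Ψ⁻¹ A Ψ` with the same invariants
(`tauTrace_conj`, `pTrace_conj`) and `F(A') = Ψ⁻¹ F(A) Ψ` (`polar_conj`).
[cite: McDuffSalamon2017, Prop. 2.5.6] -/
theorem polar_spec (σ : EuclideanSpace ℝ (Fin 4) [⋀^Fin 2]→L[ℝ] ℝ)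
    (A : EuclideanSpace ℝ (Fin 4) →L[ℝ] EuclideanSpace ℝ (Fin 4))
    (hsym : ∀ v w : EuclideanSpace ℝ (Fin 4), σ ![v, A w] = σ ![w, A v])
    (hpos : ∀ v : EuclideanSpace ℝ (Fin 4), v ≠ 0 → 0 < σ ![v, A v]) {τ p : ℝ}
    (hτ : τ = -(LinearMap.trace ℝ (EuclideanSpace ℝ (Fin 4))
      ((A * A : EuclideanSpace ℝ (Fin 4) →L[ℝ] EuclideanSpace ℝ (Fin 4)) :
        EuclideanSpace ℝ (Fin 4) →ₗ[ℝ] EuclideanSpace ℝ (Fin 4))) / 2)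
    (hp : p = τ ^ 2 / 2 - LinearMap.trace ℝ (EuclideanSpace ℝ (Fin 4))
      ((A * A * (A * A) : EuclideanSpace ℝ (Fin 4) →L[ℝ] EuclideanSpace ℝ (Fin 4)) :
        EuclideanSpace ℝ (Fin 4) →ₗ[ℝ] EuclideanSpace ℝ (Fin 4)) / 4) :
    0 < p ∧ 0 < τ + 2 * √p ∧
    ((√p * √(τ + 2 * √p))⁻¹ • (A * (A * A + (τ + √p) • 1))) *
        ((√p * √(τ + 2 * √p))⁻¹ • (A * (A * A + (τ + √p) • 1))) = -1 ∧
    ∀ v : EuclideanSpace ℝ (Fin 4), v ≠ 0 →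
      0 < σ ![v, ((√p * √(τ + 2 * √p))⁻¹ • (A * (A * A + (τ + √p) • 1))) v] := by
  -- nondegeneracy of `σ` and a symplectic frame
  have hnd : ∀ v : EuclideanSpace ℝ (Fin 4), v ≠ 0 → ∃ w, σ ![v, w] ≠ 0 :=
    fun v hv ↦ ⟨A v, (hpos v hv).ne'⟩
  obtain ⟨Ψ, hΨ⟩ := exists_continuousLinearEquiv_twoForm_eq_stdSymplecticForm σ hnd
  set T : EuclideanSpace ℝ (Fin 4) →L[ℝ] EuclideanSpace ℝ (Fin 4) :=
    (Ψ.symm : EuclideanSpace ℝ (Fin 4) →L[ℝ] EuclideanSpace ℝ (Fin 4)) with hT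
  set T' : EuclideanSpace ℝ (Fin 4) →L[ℝ] EuclideanSpace ℝ (Fin 4) :=
    (Ψ : EuclideanSpace ℝ (Fin 4) →L[ℝ] EuclideanSpace ℝ (Fin 4)) with hT'
  have hT'T : T' * T = 1 := Ψ.coe_comp_coe_symm
  have hTT' : T * T' = 1 := Ψ.coe_symm_comp_coe
  set A' := T * (A * T') with hA'
  have hA'ap : ∀ c, A' c = Ψ.symm (A (Ψ c)) := fun c ↦ rfl
  -- `A'` is `ω₀`-symmetric positive
  have hsym' : ∀ a c : EuclideanSpace ℝ (Fin 4),
      stdSymplecticForm a (A' c) = stdSymplecticForm c (A' a) := by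
    intro a c
    rw [hA'ap, hA'ap, ← hΨ, ← hΨ, Ψ.apply_symm_apply, Ψ.apply_symm_apply, hsym]
  have hpos' : ∀ a : EuclideanSpace ℝ (Fin 4), a ≠ 0 → 0 < stdSymplecticForm a (A' a) := by
    intro a ha
    rw [hA'ap, ← hΨ, Ψ.apply_symm_apply]
    exact hpos _ fun h ↦ ha (by simpa using congrArg Ψ.symm h)
  -- same invariants
  have hτ' : τ = -(LinearMap.trace ℝ (EuclideanSpace ℝ (Fin 4))
      ((A' * A' : EuclideanSpace ℝ (Fin 4) →L[ℝ] EuclideanSpace ℝ (Fin 4)) :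
        EuclideanSpace ℝ (Fin 4) →ₗ[ℝ] EuclideanSpace ℝ (Fin 4))) / 2 := by
    rw [hA', tauTrace_conj T T' A hT'T]; exact hτ
  have hp' : p = τ ^ 2 / 2 - LinearMap.trace ℝ (EuclideanSpace ℝ (Fin 4))
      ((A' * A' * (A' * A') : EuclideanSpace ℝ (Fin 4) →L[ℝ] EuclideanSpace ℝ (Fin 4)) :
        EuclideanSpace ℝ (Fin 4) →ₗ[ℝ] EuclideanSpace ℝ (Fin 4)) / 4 := by
    rw [hA', conj_mul_conj hT'T, conj_mul_conj hT'T, trace_conj T T' _ hT'T]; exact hp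
  obtain ⟨hp0, hs0, hsq', htame'⟩ := polar_spec_std hsym' hpos' hτ' hp'
  -- `F(A') = T F(A) T'`
  have hF : (√p * √(τ + 2 * √p))⁻¹ • (A' * (A' * A' + (τ + √p) • 1)) =
      T * (((√p * √(τ + 2 * √p))⁻¹ • (A * (A * A + (τ + √p) • 1))) * T') := by
    rw [hA']; exact polar_conj T T' A hT'T τ p
  set F := (√p * √(τ + 2 * √p))⁻¹ • (A * (A * A + (τ + √p) • 1)) with hFdef
  refine ⟨hp0, hs0, ?_, fun v hv ↦ ?_⟩
  · -- `F² = -1` from `F'² = -1`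
    rw [hF, conj_mul_conj hT'T] at hsq'
    have := congrArg (fun X ↦ T' * X * T) hsq'
    rw [show T' * (T * (F * F * T')) * T = (T' * T) * (F * F) * (T' * T) by simp only [mul_assoc],
      hT'T, one_mul, mul_one, mul_neg_one T', neg_mul T' T, hT'T] at this
    exact this
  · -- tameness: `σ(v, F v) = ω₀(a, F' a)` for `v = Ψ a`
    have hFap : F v = Ψ (((√p * √(τ + 2 * √p))⁻¹ • (A' * (A' * A' + (τ + √p) • 1))) (Ψ.symm v)) := by
      rw [hF]
      show F v = Ψ (Ψ.symm (F (Ψ (Ψ.symm v))))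
      rw [Ψ.apply_symm_apply, Ψ.apply_symm_apply]
    have ha : Ψ.symm v ≠ 0 := fun h ↦ hv (by simpa using congrArg Ψ h)
    have := htame' (Ψ.symm v) ha
    rw [← hΨ, Ψ.apply_symm_apply, ← hFap] at this
    exact this

/-! ### Registered helper sub-goal -/

/-- **Registered helper sub-goal `helper_tamePolarExists`**: on `ℝ⁴`, a `2`-form `σ` and an
endomorphism `A` with `σ(v, A w)` symmetric and positive definite yield a `σ`-TAME complex structure
`J` (`J² = -1`, `σ(v, Jv) > 0` for `v ≠ 0`) — the pointwise existence half of McDuff–Salamon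
(2017), Prop. 2.5.6 / §4.1, here witnessed by the explicit polar formula `F(A, τ, p)`.
[cite: McDuffSalamon2017, Prop. 2.5.6] -/
theorem helper_tamePolarExists : ∀ (σ : EuclideanSpace ℝ (Fin 4) [⋀^Fin 2]→L[ℝ] ℝ)
    (A : EuclideanSpace ℝ (Fin 4) →L[ℝ] EuclideanSpace ℝ (Fin 4)),
    (∀ v w : EuclideanSpace ℝ (Fin 4), σ ![v, A w] = σ ![w, A v]) →
    (∀ v : EuclideanSpace ℝ (Fin 4), v ≠ 0 → 0 < σ ![v, A v]) →
    ∃ J : EuclideanSpace ℝ (Fin 4) →L[ℝ] EuclideanSpace ℝ (Fin 4), J * J = -1 ∧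
      ∀ v : EuclideanSpace ℝ (Fin 4), v ≠ 0 → 0 < σ ![v, J v] := by
  intro σ A hsym hpos
  obtain ⟨-, -, hsq, htame⟩ := polar_spec σ A hsym hpos rfl rfl
  exact ⟨_, hsq, htame⟩

end Summit.SmoothPoincare4.SmoothPoincare4.Theorems.GromovRecognitionRelEnd.CrossCapLaurent

end
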